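import Summits.CriticalPhenomena.SAWScalingLimit.Theorems.SAWRenewalTightnessSubseqIdentificationWindowTransport
import Summits.CriticalPhenomena.SAWScalingLimit.Theorems.SAWTargetMonotonicityFKGGivesDomainMonotone
import Literature.Probability.RandomPlanarGeometry.SAWScalingLimitFamily
import Literature.Probability.LatticeModels.MeshDomainBigComponents
import HarnessLib

/-!
# `stub_halfBallNesting`: lattice nesting of the carved sub-domain at a flat window

Stub RS2b `stub_halfBallNesting` of the registered skeleton of the line `boundary-area-law`
(restriction reshape) for the crux `SubseqIdentification` (stmt-CriticalPhenomena-0783, route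
`SAWRenewalTightness`; primary decl `SAWParafermion.SubseqIdentification`).

Setting: a Dobrushin domain `(D; a, b)` with a FLAT HORIZONTAL WINDOW
`D ∩ B(x₀, ρ₀) = {im z > im x₀} ∩ B(x₀, ρ₀)` whose closed ball misses the marked points, `0 < r`,
`4 r ≤ ρ₀`, an endpoint approximation `(a_δ, b_δ)` of `D`, and a Dobrushin domain `D'` with carrier
`D ∖ B̄(x₀, r)` and the same marked points (a HYPOTHESIS here; its existence is the sibling stub
RS2a). Claim: (i) `(a_δ, b_δ)` is an endpoint approximation of `D'`; eventually in `δ`: (ii) every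
SAW of `D'_δ` from `a_δ` to `b_δ` is, with the same support, a SAW of `D_δ`; (iii) every SAW of
`D_δ` whose polyline stays at distance `> r` from `x₀` is one of `D'_δ`; (iv) the polyline of a SAW
of `D'_δ` stays at distance `≥ r` from `x₀`.

Proof (lattice geometry of `DomainDiscretisation.lean`; the one deep input is the tree theorem
`JordanDomain.eventually_forall_mem_meshDomain'` — for a compact `K` inside a Jordan domain and
small `δ`, the lattice points of `K` are in `meshDomain`, which is ONE mesh component — applied to
`D` and `D'` with the bulk compact `K = B̄(x₀, 7ρ₀/8) ∩ {im ≥ im x₀ + 3ρ₀/8} ⊆ D ∩ D'`, which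
contains the lattice point nearest to `x₀ + iρ₀/2`). A closed mesh edge of `D̄` off `B̄(x₀, r)`
is a mesh edge of `D̄'` (`closure D ∖ B̄ ⊆ closure D'`), e.g. any edge issued from a vertex at
distance `> r + δ` (`meshGraph_adj_carve`). ESCAPE (`mem_meshDomain_carve`): a vertex of `D_δ` at
distance `> r + δ` from `x₀` is in `D'_δ` — follow a mesh path of `D` to the bulk point; until it
first comes within `r + δ` of `x₀` it is a mesh path of `D'` (`exists_exit`); from the last vertex
`w` before (`|w − x₀| ≤ r + 2δ`: inside the window, above the wall) climb the lattice column, along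
which the distance to `x₀` increases, inside `D'` up to a lattice point of `K` (`exists_column`,
staircase lemma `meshVertexGraph_reachable_of_rectangle_subset`); `D'_δ` is a union of mesh
components containing `K`'s lattice points. Eventually the endpoints are distinct, joined in `D_δ`
and at distance `> ρ₀/2` from `x₀`, hence in `D'_δ` and joined there: (i). (ii): transfer of walks
of `D'_δ` issued from a vertex of `D_δ` (`FKGGivesDomainMonotone.exists_transfer`). (iii): the
closed edges of the walk lie on its polyline, off `B̄(x₀, r)`, and are absorbed one by one into
`D'_δ` from `a_δ ∈ D'_δ` (`exists_walk_carve`). (iv): the polyline of a `D'_δ`-walk from `a_δ`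
lies in `closure D' ∪ {δ a_δ} ⊆ ℂ ∖ B(x₀, r)`. No named fact is used.
-/

noncomputable section

open Filter Topology Set Metric Complex
open Literature.Probability.RandomPlanarGeometry Literature.Probability.LatticeModels

namespace Summit.CriticalPhenomena.SAWScalingLimit.Theorems.SubseqIdentification.BoundaryAreaLaw

namespace HalfBallNesting

variable {Ω Ω' : Set ℂ} {δ r ρ₀ : ℝ} {x₀ : ℂ}

/-- The closed segment of every dart of a walk lies on the polyline of the walk. [folklore] -/
theorem segment_subset_range_toCurve {V E : Type*} [AddCommGroup E] [Module ℝ E]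
    [TopologicalSpace E] [ContinuousAdd E] [ContinuousSMul ℝ E] {G : SimpleGraph V}
    (emb : V → E) : ∀ {u v : V} (p : G.Walk u v), ∀ d ∈ p.darts,
      segment ℝ (emb d.fst) (emb d.snd) ⊆ Set.range (p.toCurve emb)
  | _, _, SimpleGraph.Walk.nil => by simp
  | _, _, SimpleGraph.Walk.cons h q => by
    intro d hd
    rw [SimpleGraph.Walk.darts_cons, List.mem_cons] at hd
    rw [SimpleGraph.Walk.range_toCurve_cons]
    rcases hd with rfl | hd
    exacts [subset_union_left, (segment_subset_range_toCurve emb q d hd).trans subset_union_right]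

/-- A mesh edge of `Ω` whose closed segment misses `B̄(x₀, r)` is a mesh edge of
`Ω' = Ω ∖ B̄(x₀, r)` (`closure Ω ∖ B̄ ⊆ closure Ω'`). [folklore] -/
theorem meshGraph_adj_carve_of_subset (hΩ' : Ω' = Ω \ closedBall x₀ r) {x y : Site 2}
    (h : (meshGraph Ω δ).Adj x y)
    (hseg : segment ℝ (meshPoint δ x) (meshPoint δ y) ⊆ (closedBall x₀ r)ᶜ) :
    (meshGraph Ω' δ).Adj x y := by
  obtain ⟨hzd, hcl⟩ := meshGraph_adj_iff.1 h
  refine meshGraph_adj_iff.2 ⟨hzd, fun p hp => ?_⟩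
  rw [hΩ', Set.sdiff_eq, inter_comm]
  exact isClosed_closedBall.isOpen_compl.inter_closure ⟨hseg hp, hcl hp⟩

/-- A mesh edge of `Ω` issued from a vertex at distance `> r + δ` from `x₀` is a mesh edge of
`Ω' = Ω ∖ B̄(x₀, r)` (its points are within `δ` of that vertex). [folklore] -/
theorem meshGraph_adj_carve (hΩ' : Ω' = Ω \ closedBall x₀ r) (hδ : 0 < δ) {x y : Site 2}
    (hx : r + δ < dist (meshPoint δ x) x₀) (h : (meshGraph Ω δ).Adj x y) :
    (meshGraph Ω' δ).Adj x y := by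
  refine meshGraph_adj_carve_of_subset hΩ' h fun p hp hpr => ?_
  have hy : meshPoint δ y ∈ closedBall (meshPoint δ x) δ := by
    rw [mem_closedBall, dist_comm, Literature.Probability.Percolation.dist_meshPoint_of_adj
      (meshGraph_le_zdGraph _ _ h), abs_of_pos hδ]
  have h1 := (convex_closedBall _ _).segment_subset (mem_closedBall_self hδ.le) hy hp
  rw [mem_closedBall] at hpr h1
  linarith [dist_triangle (meshPoint δ x) p x₀, dist_comm (meshPoint δ x) p]

/-- A mesh vertex of `Ω` at distance `> r` from `x₀` is a mesh vertex of `Ω' = Ω ∖ B̄(x₀, r)`.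
[folklore] -/
theorem mem_meshVertices_carve (hΩ' : Ω' = Ω \ closedBall x₀ r) {x : Site 2}
    (hx : x ∈ meshVertices Ω δ) (hr : r < dist (meshPoint δ x) x₀) : x ∈ meshVertices Ω' δ := by
  rw [mem_meshVertices_iff, hΩ']
  exact ⟨hx, fun h => by rw [mem_closedBall] at h; linarith⟩

/-- **First exit.** A mesh path of `Ω` starting at distance `> r + δ` from `x₀` is a mesh path
of `Ω' = Ω ∖ B̄(x₀, r)` up to its end or up to the last vertex `w` before it first comes within
`r + δ` of `x₀`; then `r + δ < |δw - x₀| ≤ r + 2δ`. [folklore] -/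
theorem exists_exit (hΩ' : Ω' = Ω \ closedBall x₀ r) (hδ : 0 < δ) :
    ∀ {x y : meshVertices Ω δ} (_ : (meshVertexGraph Ω δ).Walk x y),
      r + δ < dist (meshPoint δ x) x₀ →
      ∃ (w : Site 2) (hx' : (x : Site 2) ∈ meshVertices Ω' δ) (hw' : w ∈ meshVertices Ω' δ),
        w ∈ meshVertices Ω δ ∧ (meshVertexGraph Ω' δ).Reachable ⟨x, hx'⟩ ⟨w, hw'⟩ ∧
        (w = y ∨ (r + δ < dist (meshPoint δ w) x₀ ∧ dist (meshPoint δ w) x₀ ≤ r + 2 * δ))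
  | x, _, SimpleGraph.Walk.nil, hx => by
    have hx' : (x : Site 2) ∈ meshVertices Ω' δ := mem_meshVertices_carve hΩ' x.2 (by linarith)
    exact ⟨x, hx', hx', x.2, SimpleGraph.Reachable.refl _, Or.inl rfl⟩
  | x, y, SimpleGraph.Walk.cons (v := x') h q, hx => by
    have hx' : (x : Site 2) ∈ meshVertices Ω' δ := mem_meshVertices_carve hΩ' x.2 (by linarith)
    have hadj : (meshGraph Ω δ).Adj x x' := by
      simpa only [SimpleGraph.comap_adj, Function.Embedding.subtype_apply] using h
    by_cases hfar : r + δ < dist (meshPoint δ (x' : Site 2)) x₀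
    · obtain ⟨w, hx'', hw', hwΩ, hreach, hend⟩ := exists_exit hΩ' hδ q hfar
      have hadj' : (meshVertexGraph Ω' δ).Adj ⟨x, hx'⟩ ⟨x', hx''⟩ := by
        simp only [SimpleGraph.comap_adj, Function.Embedding.subtype_apply]
        exact meshGraph_adj_carve hΩ' hδ hx hadj
      exact ⟨w, hx', hw', hwΩ, hadj'.reachable.trans hreach, hend⟩
    · push Not at hfar
      have hd : dist (meshPoint δ (x : Site 2)) (meshPoint δ (x' : Site 2)) = δ := by
        rw [Literature.Probability.Percolation.dist_meshPoint_of_adj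
          (meshGraph_le_zdGraph _ _ hadj), abs_of_pos hδ]
      refine ⟨x, hx', hx', x.2, SimpleGraph.Reachable.refl _, Or.inr ⟨hx, ?_⟩⟩
      linarith [dist_triangle (meshPoint δ (x : Site 2)) (meshPoint δ (x' : Site 2)) x₀]

/-- **Transfer off the ball.** A walk of `Ω_δ` starting in `meshDomain Ω' δ` all of whose closed
edges miss `B̄(x₀, r)` is, with the same support, a walk of `Ω'_δ` (`Ω'_δ` is a union of mesh
components, so the vertices are absorbed one by one). [folklore] -/
theorem exists_walk_carve (hΩ' : Ω' = Ω \ closedBall x₀ r) :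
    ∀ {x y : Site 2} (p : (discreteDomainGraph Ω δ).Walk x y), x ∈ meshDomain Ω' δ →
      (∀ d ∈ p.darts, segment ℝ (meshPoint δ d.fst) (meshPoint δ d.snd) ⊆ (closedBall x₀ r)ᶜ) →
      ∃ p' : (discreteDomainGraph Ω' δ).Walk x y, p'.support = p.support
  | _, _, SimpleGraph.Walk.nil, _, _ => ⟨SimpleGraph.Walk.nil, rfl⟩
  | x, y, SimpleGraph.Walk.cons (v := z) h q, hx, hd => by
    obtain ⟨hm, -, hzD⟩ := discreteDomainGraph_adj_iff.1 h
    rw [SimpleGraph.Walk.darts_cons] at hd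
    have hseg := hd _ List.mem_cons_self
    have hm' : (meshGraph Ω' δ).Adj x z := meshGraph_adj_carve_of_subset hΩ' hm hseg
    have hz' : z ∈ meshVertices Ω' δ := by
      rw [mem_meshVertices_iff, hΩ']
      exact ⟨meshDomain_subset_meshVertices _ _ hzD, hseg (right_mem_segment _ _ _)⟩
    have hzD' : z ∈ meshDomain Ω' δ :=
      Literature.Probability.Percolation.mem_meshDomain_of_meshGraph_adj hx hz' hm'
    obtain ⟨q', hq'⟩ := exists_walk_carve hΩ' q hzD' fun d hd' => hd d (List.mem_cons_of_mem _ hd')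
    exact ⟨SimpleGraph.Walk.cons (discreteDomainGraph_adj_iff.2 ⟨hm', hx, hzD'⟩) q', by
      rw [SimpleGraph.Walk.support_cons, SimpleGraph.Walk.support_cons, hq']⟩

/-- The lattice point nearest to `x₀ + iρ₀/2` has its mesh point in the bulk compact
`K = B̄(x₀, 7ρ₀/8) ∩ {im ≥ im x₀ + 3ρ₀/8}` once `δ < ρ₀/24`. [folklore] -/
theorem meshPoint_nearestSite_mem (hρ₀ : 0 < ρ₀) (hδ : 0 < δ) (hδρ : δ < ρ₀ / 24) :
    meshPoint δ (nearestSite δ (x₀ + (ρ₀ / 2 : ℝ) * I)) ∈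
      closedBall x₀ (7 * ρ₀ / 8) ∩ {z : ℂ | x₀.im + 3 * ρ₀ / 8 ≤ z.im} := by
  set c : ℂ := x₀ + (ρ₀ / 2 : ℝ) * I with hc_def
  have hd : dist (meshPoint δ (nearestSite δ c)) c ≤ δ := dist_meshPoint_nearestSite_le hδ c
  have hc : dist c x₀ = ρ₀ / 2 := by
    rw [dist_eq_norm, hc_def, add_sub_cancel_left, norm_mul, norm_real, norm_I, mul_one,
      Real.norm_eq_abs, abs_of_pos (half_pos hρ₀)]
  have hcim : c.im = x₀.im + ρ₀ / 2 := by simp [hc_def]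
  constructor
  · rw [mem_closedBall]
    linarith [dist_triangle (meshPoint δ (nearestSite δ c)) c x₀]
  · show x₀.im + 3 * ρ₀ / 8 ≤ (meshPoint δ (nearestSite δ c)).im
    have h1 := abs_im_le_norm (meshPoint δ (nearestSite δ c) - c)
    rw [← dist_eq_norm, sub_im, hcim] at h1
    have h2 := (abs_le.1 (h1.trans hd)).1
    linarith

/-- The bulk compact `K` lies in `Ω' = Ω ∖ B̄(x₀, r) ⊆ Ω` (window identity). [folklore] -/
theorem bulk_subset (hΩo : IsOpen Ω) (hwin : Ω ∩ ball x₀ ρ₀ = {z : ℂ | x₀.im < z.im} ∩ ball x₀ ρ₀)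
    (hΩ' : Ω' = Ω \ closedBall x₀ r) (hρ₀ : 0 < ρ₀) (hrρ : 4 * r ≤ ρ₀) :
    closedBall x₀ (7 * ρ₀ / 8) ∩ {z : ℂ | x₀.im + 3 * ρ₀ / 8 ≤ z.im} ⊆ Ω' ∧ Ω' ⊆ Ω := by
  refine ⟨fun z hz => ?_, fun z hz => by rw [hΩ'] at hz; exact hz.1⟩
  obtain ⟨hz1, hz2⟩ := hz
  have hz2' : x₀.im + 3 * ρ₀ / 8 ≤ z.im := hz2
  rw [mem_closedBall] at hz1
  have hzb : z ∈ ball x₀ ρ₀ := mem_ball.2 (by linarith)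
  rw [hΩ']
  refine ⟨((window_mem_iff hΩo hwin hzb).1).2 (by linarith), fun h => ?_⟩
  rw [mem_closedBall, dist_eq_norm] at h
  have h1 := abs_im_le_norm (z - x₀)
  rw [sub_im] at h1
  have h2 := (abs_le.1 (h1.trans h)).2
  linarith

/-- **Column escape.** From a mesh vertex `w` of `Ω` with `r < |δw - x₀| ≤ r + 2δ` (inside the
window, above the wall) the lattice column climbs inside `Ω' = Ω ∖ B̄(x₀, r)` — the distance to
`x₀` increases along it — to a lattice point of the bulk compact `K`; by the staircase lemma the
two are joined in the mesh graph of `Ω'`. [folklore] -/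
theorem exists_column (hΩo : IsOpen Ω)
    (hwin : Ω ∩ ball x₀ ρ₀ = {z : ℂ | x₀.im < z.im} ∩ ball x₀ ρ₀)
    (hΩ' : Ω' = Ω \ closedBall x₀ r) (hrρ : 4 * r ≤ ρ₀) (hδ : 0 < δ)
    (hδρ : δ < ρ₀ / 24) {w : Site 2} (hw : w ∈ meshVertices Ω δ)
    (hw₁ : r < dist (meshPoint δ w) x₀) (hw₂ : dist (meshPoint δ w) x₀ ≤ r + 2 * δ) :
    ∃ (k : Site 2) (hw' : w ∈ meshVertices Ω' δ) (hk' : k ∈ meshVertices Ω' δ),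
      meshPoint δ k ∈ closedBall x₀ (7 * ρ₀ / 8) ∩ {z : ℂ | x₀.im + 3 * ρ₀ / 8 ≤ z.im} ∧
      (meshVertexGraph Ω' δ).Reachable ⟨w, hw'⟩ ⟨k, hk'⟩ := by
  -- the number of steps `c`: `ρ₀/2 ≤ c δ < ρ₀/2 + δ`
  set c : ℕ := ⌈ρ₀ / (2 * δ)⌉₊ with hc_def
  have hc₁ : ρ₀ / 2 ≤ c * δ := by
    have h1 : ρ₀ / (2 * δ) ≤ c := Nat.le_ceil _
    rw [div_le_iff₀ (by positivity)] at h1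
    linarith
  have hρ₀ : 0 < ρ₀ := by linarith
  have hc₂ : (c : ℝ) * δ < ρ₀ / 2 + δ := by
    have h1 : (c : ℝ) < ρ₀ / (2 * δ) + 1 := Nat.ceil_lt_add_one (by positivity)
    have h2 : (c : ℝ) * δ < (ρ₀ / (2 * δ) + 1) * δ := mul_lt_mul_of_pos_right h1 hδ
    have h3 : (ρ₀ / (2 * δ) + 1) * δ = ρ₀ / 2 + δ := by field_simp
    linarith
  set k : Site 2 := w + Pi.single 1 (c : ℤ) with hk_def
  have hk0 : k 0 = w 0 := by simp [hk_def]
  have hk1 : k 1 = w 1 + c := by simp [hk_def]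
  have hre : (meshPoint δ k).re = (meshPoint δ w).re := by rw [meshPoint_re, meshPoint_re, hk0]
  have him : (meshPoint δ k).im = (meshPoint δ w).im + c * δ := by
    rw [meshPoint_im, meshPoint_im, hk1]; push_cast; ring
  have hwball : meshPoint δ w ∈ ball x₀ ρ₀ := mem_ball.2 (by linarith)
  have hwim : x₀.im < (meshPoint δ w).im := ((window_mem_iff hΩo hwin hwball).1).1 hw
  -- the vertical segment `[δw, δk]` lies in `Ω'`
  have hseg : Rectangle (meshPoint δ w) (meshPoint δ k) ⊆ Ω' := by
    intro p hp
    rw [Rectangle, mem_reProdIm, hre, uIcc_self, mem_singleton_iff, him,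
      uIcc_of_le (by nlinarith), mem_Icc] at hp
    obtain ⟨hpre, hpim1, hpim2⟩ := hp
    have h1 : dist p (meshPoint δ w) ≤ c * δ := by
      rw [dist_eq_norm]
      refine (norm_le_abs_re_add_abs_im _).trans ?_
      rw [sub_re, sub_im, hpre, sub_self, abs_zero, zero_add, abs_of_nonneg (by linarith)]
      linarith
    have h2 : dist p x₀ < ρ₀ := by linarith [dist_triangle p (meshPoint δ w) x₀]
    have hpΩ : p ∈ Ω := ((window_mem_iff hΩo hwin (mem_ball.2 h2)).1).2 (by linarith)
    have h4 : r < dist p x₀ := by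
      rw [dist_eq_norm] at hw₁ ⊢
      have e1 : ‖meshPoint δ w - x₀‖ ^ 2 =
          ((meshPoint δ w).re - x₀.re) ^ 2 + ((meshPoint δ w).im - x₀.im) ^ 2 := by
        rw [Complex.sq_norm, normSq_apply, sub_re, sub_im]; ring
      have e2 : ‖p - x₀‖ ^ 2 = (p.re - x₀.re) ^ 2 + (p.im - x₀.im) ^ 2 := by
        rw [Complex.sq_norm, normSq_apply, sub_re, sub_im]; ring
      have h5 : ‖meshPoint δ w - x₀‖ ^ 2 ≤ ‖p - x₀‖ ^ 2 := by
        rw [e1, e2, hpre]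
        nlinarith
      exact hw₁.trans_le (le_of_pow_le_pow_left₀ two_ne_zero (norm_nonneg _) h5)
    rw [hΩ']
    exact ⟨hpΩ, fun h => by rw [mem_closedBall] at h; linarith⟩
  have hw' : w ∈ meshVertices Ω' δ := hseg (left_mem_rectangle _ _)
  have hk' : k ∈ meshVertices Ω' δ := hseg (right_mem_rectangle _ _)
  refine ⟨k, hw', hk', ⟨?_, ?_⟩,
    meshVertexGraph_reachable_of_rectangle_subset hδ _ w k rfl hseg hw' hk'⟩
  · rw [mem_closedBall]
    have h1 : dist (meshPoint δ k) (meshPoint δ w) ≤ c * δ := by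
      rw [dist_eq_norm]
      refine (norm_le_abs_re_add_abs_im _).trans ?_
      rw [sub_re, sub_im, hre, sub_self, abs_zero, zero_add, him, add_sub_cancel_left,
        abs_of_nonneg (by positivity)]
    linarith [dist_triangle (meshPoint δ k) (meshPoint δ w) x₀]
  · show x₀.im + 3 * ρ₀ / 8 ≤ (meshPoint δ k).im
    linarith [him]

/-- **Escape to the carved discrete domain.** With `K` the bulk compact: if the lattice points of
`K` lie in `meshDomain Ω' δ`, a lattice point `z₀` lies in `meshDomain Ω δ` and in
`meshDomain Ω' δ`, and `meshDomain Ω δ` is a single mesh component, then every vertex of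
`meshDomain Ω δ` at distance `> r + δ` from `x₀` lies in `meshDomain Ω' δ` (first exit + column
escape; `meshDomain Ω' δ` is a union of mesh components). [folklore] -/
theorem mem_meshDomain_carve (hΩo : IsOpen Ω)
    (hwin : Ω ∩ ball x₀ ρ₀ = {z : ℂ | x₀.im < z.im} ∩ ball x₀ ρ₀)
    (hΩ' : Ω' = Ω \ closedBall x₀ r) (hrρ : 4 * r ≤ ρ₀) (hδ : 0 < δ) (hδρ : δ < ρ₀ / 24)
    (hK' : ∀ x : Site 2, meshPoint δ x ∈ closedBall x₀ (7 * ρ₀ / 8) ∩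
      {z : ℂ | x₀.im + 3 * ρ₀ / 8 ≤ z.im} → x ∈ meshDomain Ω' δ)
    {z₀ : Site 2} (hz₀ : z₀ ∈ meshDomain Ω δ) (hz₀' : z₀ ∈ meshDomain Ω' δ)
    (hJ : ∀ x ∈ meshDomain Ω δ, ∀ y ∈ meshDomain Ω δ,
      ∃ (hx : x ∈ meshVertices Ω δ) (hy : y ∈ meshVertices Ω δ),
        (meshVertexGraph Ω δ).Reachable ⟨x, hx⟩ ⟨y, hy⟩)
    {v : Site 2} (hv : v ∈ meshDomain Ω δ) (hvfar : r + δ < dist (meshPoint δ v) x₀) :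
    v ∈ meshDomain Ω' δ := by
  obtain ⟨hvV, hz₀V, ⟨p⟩⟩ := hJ v hv z₀ hz₀
  obtain ⟨w, hv', hw', hwΩ, hreach, hend⟩ := exists_exit hΩ' hδ p hvfar
  rcases hend with rfl | ⟨hw₁, hw₂⟩
  · exact mem_meshDomain_of_reachable_meshVertexGraph hz₀' hw' hv' hreach.symm
  · obtain ⟨k, hw'', hk', hkK, hreach'⟩ :=
      exists_column hΩo hwin hΩ' hrρ hδ hδρ hwΩ (by linarith) hw₂
    exact mem_meshDomain_of_reachable_meshVertexGraph (hK' k hkK) hk' hv'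
      (hreach.trans hreach').symm

end HalfBallNesting

open HalfBallNesting
open Summit.CriticalPhenomena.SAWScalingLimit.Theorems.SAWTargetMonotonicity
  (FKGGivesDomainMonotone.exists_transfer FKGGivesDomainMonotone.mem_meshDomain_of_reachable)

/-- **RS2b — lattice nesting of the carved sub-domain and the sandwich of the confinement event
(stub `stub_halfBallNesting`).** For a Dobrushin domain `(D; a, b)` with a flat horizontal window
`D ∩ B(x₀, ρ₀) = {im z > im x₀} ∩ B(x₀, ρ₀)`, `ρ₀ ≤ |x₀ - a|`, `ρ₀ ≤ |x₀ - b|`, `0 < r`, `4 r ≤ ρ₀`,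
an endpoint approximation `(a_δ, b_δ)` of `D` and a Dobrushin domain `D'` with carrier
`D ∖ B̄(x₀, r)` and the same marked points: (i) `(a_δ, b_δ)` is an endpoint approximation of `D'`;
and for all small `δ > 0`, (ii) every SAW of `D'_δ` from `a_δ` to `b_δ` is, with the same support,
a SAW of `D_δ`, (iii) every SAW of `D_δ` whose polyline stays at distance `> r` from `x₀` is, with
the same support, a SAW of `D'_δ`, (iv) the polyline of a SAW of `D_δ` that is a SAW of `D'_δ`
stays at distance `≥ r` from `x₀`. See the module docstring for the proof. [folklore] -/
theorem stub_halfBallNesting :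
    ∀ (D D' : DobrushinDomain) (a b : ℝ → Site 2) (x₀ : ℂ) (ρ₀ r : ℝ),
      SAW.IsEndpointApprox D a b → 0 < r → 4 * r ≤ ρ₀ →
      D.carrier ∩ Metric.ball x₀ ρ₀ = {z : ℂ | x₀.im < z.im} ∩ Metric.ball x₀ ρ₀ →
      ρ₀ ≤ dist x₀ (D.pt 0) → ρ₀ ≤ dist x₀ (D.pt 1) →
      D'.carrier = D.carrier \ Metric.closedBall x₀ r → D'.pt 0 = D.pt 0 → D'.pt 1 = D.pt 1 →
      SAW.IsEndpointApprox D' a b ∧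
        ∀ᶠ δ in 𝓝[>] (0 : ℝ),
          (∀ γ' : SAW.DomainSAW D'.carrier δ (a δ) (b δ),
              ∃ γ : SAW.DomainSAW D.carrier δ (a δ) (b δ), γ.walk.support = γ'.walk.support) ∧
          (∀ γ : SAW.DomainSAW D.carrier δ (a δ) (b δ), r < Metric.infDist x₀ γ.curve.range →
              ∃ γ' : SAW.DomainSAW D'.carrier δ (a δ) (b δ), γ'.walk.support = γ.walk.support) ∧
          (∀ γ : SAW.DomainSAW D.carrier δ (a δ) (b δ),
              (∃ γ' : SAW.DomainSAW D'.carrier δ (a δ) (b δ), γ'.walk.support = γ.walk.support) →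
              r ≤ Metric.infDist x₀ γ.curve.range) := by
  intro D D' a b x₀ ρ₀ r hab hr hrρ hwin h0 h1 hD' hD'0 hD'1
  have hρ₀ : 0 < ρ₀ := by linarith
  obtain ⟨hKΩ', hsub⟩ := bulk_subset D.isOpen hwin hD' hρ₀ hrρ
  have hKc : IsCompact (closedBall x₀ (7 * ρ₀ / 8) ∩ {z : ℂ | x₀.im + 3 * ρ₀ / 8 ≤ z.im}) :=
    (isCompact_closedBall _ _).inter_right (isClosed_le continuous_const continuous_im)
  have hJ := D.toJordanDomain.eventually_forall_mem_meshDomain' hKc (hKΩ'.trans hsub)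
  have hJ' := D'.toJordanDomain.eventually_forall_mem_meshDomain' hKc hKΩ'
  have hfar : ∀ (i : Fin 2) (c : ℝ → Site 2),
      Tendsto (fun δ => meshPoint δ (c δ)) (𝓝[>] (0 : ℝ)) (𝓝 (D.pt i)) →
      ρ₀ ≤ dist x₀ (D.pt i) → ∀ᶠ δ in 𝓝[>] (0 : ℝ), ρ₀ / 2 < dist (meshPoint δ (c δ)) x₀ := by
    intro i c hc hi
    filter_upwards [Metric.tendsto_nhds.1 hc (ρ₀ / 2) (half_pos hρ₀)] with δ hδ
    linarith [dist_triangle x₀ (meshPoint δ (c δ)) (D.pt i), dist_comm x₀ (meshPoint δ (c δ))]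
  have hne : ∀ᶠ δ in 𝓝[>] (0 : ℝ), a δ ≠ b δ := by
    have hpt : D.pt 0 ≠ D.pt 1 := fun h ↦ absurd (D.pt_injective h) (by decide)
    have hd : 0 < dist (D.pt 0) (D.pt 1) := dist_pos.2 hpt
    filter_upwards [Metric.tendsto_nhds.1 hab.tendsto_fst _ (half_pos hd),
      Metric.tendsto_nhds.1 hab.tendsto_snd _ (half_pos hd)] with δ ha hb heq
    rw [heq] at ha
    linarith [dist_triangle_left (D.pt 0) (D.pt 1) (meshPoint δ (b δ))]
  have key : ∀ᶠ δ in 𝓝[>] (0 : ℝ), 0 < δ ∧ a δ ∈ meshDomain D.carrier δ ∧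
      a δ ∈ meshDomain D'.carrier δ ∧ b δ ∈ meshDomain D'.carrier δ ∧
      ρ₀ / 2 < dist (meshPoint δ (a δ)) x₀ ∧
      (∀ x ∈ meshDomain D'.carrier δ, ∀ y ∈ meshDomain D'.carrier δ,
        ∃ (hx : x ∈ meshVertices D'.carrier δ) (hy : y ∈ meshVertices D'.carrier δ),
          (meshVertexGraph D'.carrier δ).Reachable ⟨x, hx⟩ ⟨y, hy⟩) := by
    filter_upwards [hJ, hJ', hfar 0 a hab.tendsto_fst h0, hfar 1 b hab.tendsto_snd h1, hne,
      hab.reachable, Ioo_mem_nhdsGT (show (0 : ℝ) < ρ₀ / 24 by positivity)]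
      with δ hJ hJ' hfa hfb hne hreach hδ
    have hz₀K := meshPoint_nearestSite_mem (x₀ := x₀) hρ₀ hδ.1 hδ.2
    have haD : a δ ∈ meshDomain D.carrier δ :=
      FKGGivesDomainMonotone.mem_meshDomain_of_reachable hne hreach
    have hbD : b δ ∈ meshDomain D.carrier δ :=
      FKGGivesDomainMonotone.mem_meshDomain_of_reachable hne.symm hreach.symm
    refine ⟨hδ.1, haD, ?_, ?_, hfa, hJ'.2⟩
    · exact mem_meshDomain_carve D.isOpen hwin hD' hrρ hδ.1 hδ.2 hJ'.1 (hJ.1 _ hz₀K)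
        (hJ'.1 _ hz₀K) hJ.2 haD (by linarith [hδ.2])
    · exact mem_meshDomain_carve D.isOpen hwin hD' hrρ hδ.1 hδ.2 hJ'.1 (hJ.1 _ hz₀K)
        (hJ'.1 _ hz₀K) hJ.2 hbD (by linarith [hδ.2])
  constructor
  · -- (i) the endpoint approximation of `D'`
    refine ⟨?_, by rw [hD'0]; exact hab.tendsto_fst, by rw [hD'1]; exact hab.tendsto_snd⟩
    filter_upwards [key] with δ ⟨_, _, haD', hbD', _, hJ'⟩
    obtain ⟨_, _, ⟨q⟩⟩ := hJ' _ haD' _ hbD'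
    exact reachable_discreteDomainGraph_of_walk q haD'
  · filter_upwards [key] with δ ⟨hδ, haD, haD', hbD', hfa, _⟩
    refine ⟨fun γ' => ?_, fun γ hγ => ?_, ?_⟩
    · -- (ii) nesting: walks of `D'_δ` issued from `a δ ∈ D_δ` are walks of `D_δ`
      obtain ⟨Φ, -, hΦ, -⟩ := FKGGivesDomainMonotone.exists_transfer (b := b δ) hsub haD
      exact ⟨Φ γ', hΦ γ'⟩
    · -- (iii) walks off the closed ball are walks of `D'_δ`
      have hd : ∀ d ∈ γ.walk.darts,
          segment ℝ (meshPoint δ d.fst) (meshPoint δ d.snd) ⊆ (closedBall x₀ r)ᶜ := by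
        intro d hd p hp hpr
        have hp' : p ∈ γ.curve.range := segment_subset_range_toCurve _ γ.walk d hd hp
        have h2 := Metric.infDist_le_dist_of_mem (x := x₀) hp'
        rw [mem_closedBall, dist_comm] at hpr
        linarith
      obtain ⟨p', hp'⟩ := exists_walk_carve hD' γ.walk haD' hd
      refine ⟨⟨p', ?_⟩, hp'⟩
      rw [SimpleGraph.Walk.isPath_def, hp']
      exact (SimpleGraph.Walk.isPath_def _).1 γ.isPath
    · -- (iv) walks of `D'_δ` stay off the open ball
      rintro γ ⟨γ', hγ'⟩
      have hrange : γ.curve.range = Set.range (γ'.walk.toCurve (meshPoint δ)) := by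
        show Set.range (γ.walk.toCurve (meshPoint δ)) = _
        simp only [SimpleGraph.Walk.toCurve, hγ']
      have hcl : closure D'.carrier ⊆ (ball x₀ r)ᶜ := by
        refine closure_minimal (fun z hz hzb => ?_) isOpen_ball.isClosed_compl
        rw [hD'] at hz
        exact hz.2 (ball_subset_closedBall hzb)
      have hsubset : Set.range (γ'.walk.toCurve (meshPoint δ)) ⊆ (ball x₀ r)ᶜ := by
        refine SimpleGraph.Walk.range_toCurve_subset γ'.walk (fun h => ?_) fun d _ => ?_
        · rw [mem_ball] at h
          linarith
        · exact (meshGraph_adj_iff.1 (discreteDomainGraph_le_meshGraph _ _ d.adj)).2.trans hcl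
      rw [hrange]
      by_contra hlt
      push Not at hlt
      obtain ⟨z, hz, hzr⟩ := (Metric.infDist_lt_iff (Set.range_nonempty _)).1 hlt
      have := hsubset hz
      rw [mem_compl_iff, mem_ball, dist_comm, not_lt] at this
      linarith

end Summit.CriticalPhenomena.SAWScalingLimit.Theorems.SubseqIdentification.BoundaryAreaLaw

end
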